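import Summits.BirchSwinnertonDyer.BirchSwinnertonDyer.Theorems.KimAtThreePortSharedSATCore
import Literature.NumberTheory.AdelicBaseChange.PadicTensorCompletionTraceProofs
import Literature.NumberTheory.AdelicBaseChange.PadicTensorCompletionSurjProofs
import HarnessLib

/-!
# SEMI-LOCAL TRANSPORT for crux `KatoKuriharaPortThreeShared` (stmt-BirchSwinnertonDyer-19560): the
# SAT₀/COMPAT package in the tensor algebra `ℚ_p ⊗_ℚ ℚ(ζ_m)` (lattice `Λ₀ ⊆ L_int′`, unit-trace element,
# `M ⊆ Λ₀^∨`, COMPAT) ⟸ a PER-FACTOR package over the completions `ℚ(ζ_m)_w`, `w ∣ p`, along ANY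
# `Ψ : ℚ_p ⊗ ℚ(ζ_m) ≃ₐ ∏_{w∣p} ℚ(ζ_m)_w` with w2-acc4's pure-tensor formula
# (cell `bsd-addord`, seat kim3 gen 14 = the crux's LEAD; route W2 `KimAtThreeKolyvagin`; `--supports 19560`)

HONEST FRAMING.  TOOL theorems only (no definition, no named fact, no `sorry`); pure semi-local algebra,
any prime `p`, any level `m`; nothing about a curve is asserted; closes nothing; nothing booked.

WHY.  The registered stub `stub_definedKatoPackage` = `hK` of 19560 (line `DefinedKato`, kim3 g13
p490927/p491642) displays ONE clause in the tensor algebra `ℚ₃ ⊗_ℚ ℚ(ζ_m)` — per depth `j` and tame level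
`r`: a lattice `Λ₀` with a unit-trace element, a `ℤ₃`-module `M` with `Tr(M·Λ₀) ⊆ ℤ₃`, and COMPAT
`exp*_ω(h) ⊗ 1 − Λ_{0,r}(y) ∈ 3^{j+1}·M` — while every seat that SUPPLIES its content works inside ONE
completion `L_w = ℚ(ζ_m)_w` (w2-kport's logarithms `log_ω E₀(L_w)`, w2-acc5's Galois side at `w`, [BK90]
over `L_w`).  w2-acc4 g3 built the bridge: `Ψ : ℚ_[p] ⊗[ℚ] L ≃ₐ[ℚ] ∏_{w ∣ v_p} L_w` with
`Ψ(s ⊗ x)_w = x · e_p(s)` (`exists_padicTensorAlgEquiv`, Cassels–Fröhlich II (10.2)), `e_p`-semilinearity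
(`padicTensor_map_smul`), `Ψ(L_int′) = ∏_w 𝒪_w` INTO (`padicTensor_mem_adicCompletionIntegers_of_mem_span`)
and ONTO (`exists_mem_span_padicTensor_eq`, Serre CL II §3 Prop. 4) for `L_int′ := ℤ_p⟨1 ⊗ b : b ∈ 𝓞_L⟩`,
and `e_p(Tr x) = Σ_w Tr_{L_w/ℚ_v}(Ψ x _w)` (`padicTensor_trace`).  THIS FILE is the ~100-line transport
announced in kim3 g13's HANDOFF (ii):

* `norm_sum_le_one` — the ultrametric inequality for finite sums in `ℚ_[p]`;
* **`semiLocalInt_package_of_perFactor`** — from per-factor data (sets `Λ₀ʷ ⊆ 𝒪_w` containing `0`, sets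
  `Mʷ ⊆ L_w` with `‖e_p⁻¹Tr_w(μℓ)‖ ≤ 1` on `Mʷ × Λ₀ʷ`, ONE factor `w₀` with `ℓ₀ ∈ Λ₀^{w₀}`,
  `‖e_p⁻¹Tr_{w₀} ℓ₀‖ = 1`) to the semi-local package: `Λ₀ := L_int′ ∩ Ψ⁻¹(∏Λ₀ʷ)`, the unit-trace element
  `Ψ⁻¹(ℓ₀ at w₀, 0 elsewhere)`, `M := ℤ_p⟨Ψ⁻¹(∏Mʷ)⟩`, and the COMPAT TRANSPORT
  `(∀ w, ∃ μ_w ∈ Mʷ, Ψ(D)_w = p^{k+1}μ_w) ⟹ ∃ μ ∈ M, D = p^{k+1} • μ`.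

Consumer: `KimAtThreeFineKatoSemiLocalAssembly` (same seat, same gen): `stub_fineKato` ⟸ the PER-FACTOR
defined-Kato package `hKloc`.

References: J. W. S. Cassels, A. Fröhlich, *Algebraic Number Theory* (1967) Ch. II §10 (10.2), §11
[CasselsFrohlichANT1967]; J.-P. Serre, *Local Fields* II §3 Prop. 4 [SerreLocalFields1979]; C.-H. Kim,
AJM 148 (2026) §3.4.1 and the proof of Thm. 3.13 [Kim2022StructureSelmer]; kim3 memo KIM3-W2-C1b-KERNEL-g13
§3; w2-acc4 memo W2ACC4-g3-KPORT-NOTE (HOME/w2acc4/g3/).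
-/
noncomputable section

-- the cell's Theorems namespace `Summit.BirchSwinnertonDyer.BirchSwinnertonDyer.…` repeats the summit name by design (D-0017)
set_option linter.dupNamespace false

open scoped NumberField TensorProduct
open NumberField IsDedekindDomain
open Literature.NumberTheory.AdelicBaseChange
open Summit.BirchSwinnertonDyer.BirchSwinnertonDyer.Theorems.KimAtThreePortSharedSATCore

namespace Summit.BirchSwinnertonDyer.BirchSwinnertonDyer.Theorems.KimAtThreeFineKatoSemiLocalTransport

section PerFactor

variable (p : ℕ) [Fact p.Prime] (m : ℕ)

/-- The ultrametric inequality for finite sums in `ℚ_[p]`: if every `‖f i‖ ≤ 1` then `‖Σ_{i∈s} f i‖ ≤ 1`.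
[folklore] -/
theorem norm_sum_le_one {ι : Type*} (s : Finset ι) (f : ι → ℚ_[p]) (hf : ∀ i ∈ s, ‖f i‖ ≤ 1) :
    ‖∑ i ∈ s, f i‖ ≤ 1 := by
  classical
  induction s using Finset.induction_on with
  | empty => simp
  | insert a s ha ih =>
    rw [Finset.sum_insert ha]
    exact (Padic.nonarchimedean _ _).trans (max_le (hf a (Finset.mem_insert_self a s))
      (ih fun i hi => hf i (Finset.mem_insert_of_mem hi)))

/-- **The semi-local SAT₀/COMPAT package (in the `L_int′` currency) FROM A PER-FACTOR PACKAGE over the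
completions `L_w`, `w ∣ p`, of `L = ℚ(ζ_m)`** — pure semi-local algebra, any prime `p`, any `m`.  Data: a
`ℚ`-algebra isomorphism `Ψ : ℚ_[p] ⊗[ℚ] ℚ(ζ_m) ≃ₐ[ℚ] ∏_{w ∣ v_p} L_w` with the pure-tensor formula
`Ψ(s ⊗ x)_w = x · e_p(s)` (w2-acc4 `exists_padicTensorAlgEquiv`), and for every `w`: a set `Λ₀ʷ ⊆ 𝒪_w`
containing `0`, a set `Mʷ ⊆ L_w` with `‖e_p⁻¹ Tr_{L_w/ℚ_v}(μ ℓ)‖ ≤ 1` for `μ ∈ Mʷ`, `ℓ ∈ Λ₀ʷ`, and ONE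
factor `w₀` carrying `ℓ₀ ∈ Λ₀^{w₀}` with `‖e_p⁻¹ Tr_{w₀}(ℓ₀)‖ = 1`.  Conclusion: a set `Λ₀ ⊆ L_int′(m) =
ℤ_p⟨1 ⊗ 𝓞_{ℚ(ζ_m)}⟩` with an element of unit trace `‖Tr_{(ℚ_p ⊗ ℚ(ζ_m))/ℚ_p} ℓ‖ = 1`, a `ℤ_p`-submodule
`M` with `‖Tr(μ ℓ)‖ ≤ 1` on `M × Λ₀`, and the COMPAT TRANSPORT: whenever `Ψ(D)_w = p^{k+1} · μ_w` with
`μ_w ∈ Mʷ` for every `w`, then `D = p^{k+1} • μ` for some `μ ∈ M`.  Construction: `Λ₀ := L_int′ ∩ Ψ⁻¹(∏Λ₀ʷ)`,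
unit element `= Ψ⁻¹(ℓ₀ at w₀, 0 elsewhere) ∈ L_int′` by ONTO (`exists_mem_span_padicTensor_eq`) and
`Tr = e_p⁻¹ Σ_w Tr_w` (`padicTensor_trace`); `M := ℤ_p⟨{x | ∀ w, Ψ x _w ∈ Mʷ}⟩` (span induction, ultrametric
inequality); transport by injectivity and `e_p`-semilinearity of `Ψ` (`padicTensor_map_smul`).  Nothing about a
curve is asserted. [cite: CasselsFrohlichANT1967, Ch. II §10 Theorem (10.2) and §11]
[cite: Kim2022StructureSelmer, §3.4.1 and the proof of Thm. 3.13 (arXiv v3 pp. 26–27)] -/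
theorem semiLocalInt_package_of_perFactor
    (Ψ : ℚ_[p] ⊗[ℚ] CyclotomicField m ℚ ≃ₐ[ℚ]
      (Π w : ((Rat.HeightOneSpectrum.primesEquiv (R := 𝓞 ℚ)).symm ⟨p, Fact.out⟩).Extension
        (𝓞 (CyclotomicField m ℚ)), w.1.adicCompletion (CyclotomicField m ℚ)))
    (hΨ : ∀ (s : ℚ_[p]) (x : CyclotomicField m ℚ)
      (w : ((Rat.HeightOneSpectrum.primesEquiv (R := 𝓞 ℚ)).symm ⟨p, Fact.out⟩).Extension
        (𝓞 (CyclotomicField m ℚ))),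
      Ψ (s ⊗ₜ[ℚ] x) w = algebraMap (CyclotomicField m ℚ) (w.1.adicCompletion (CyclotomicField m ℚ)) x *
        algebraMap (((Rat.HeightOneSpectrum.primesEquiv (R := 𝓞 ℚ)).symm ⟨p, Fact.out⟩).adicCompletion ℚ)
          (w.1.adicCompletion (CyclotomicField m ℚ)) (Padic.adicCompletionEquiv (𝓞 ℚ) ⟨p, Fact.out⟩ s))
    (Λ₀' M' : ∀ w : ((Rat.HeightOneSpectrum.primesEquiv (R := 𝓞 ℚ)).symm ⟨p, Fact.out⟩).Extension
        (𝓞 (CyclotomicField m ℚ)), Set (w.1.adicCompletion (CyclotomicField m ℚ)))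
    (hΛ₀' : ∀ w, Λ₀' w ⊆ w.1.adicCompletionIntegers (CyclotomicField m ℚ))
    (h0 : ∀ w, (0 : w.1.adicCompletion (CyclotomicField m ℚ)) ∈ Λ₀' w)
    (hu' : ∃ w₀, ∃ ℓ₀ ∈ Λ₀' w₀, ‖(Padic.adicCompletionEquiv (𝓞 ℚ) ⟨p, Fact.out⟩).symm
      (Algebra.trace (((Rat.HeightOneSpectrum.primesEquiv (R := 𝓞 ℚ)).symm ⟨p, Fact.out⟩).adicCompletion ℚ)
        (w₀.1.adicCompletion (CyclotomicField m ℚ)) ℓ₀)‖ = 1)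
    (hM' : ∀ w, ∀ μ ∈ M' w, ∀ ℓ ∈ Λ₀' w, ‖(Padic.adicCompletionEquiv (𝓞 ℚ) ⟨p, Fact.out⟩).symm
      (Algebra.trace (((Rat.HeightOneSpectrum.primesEquiv (R := 𝓞 ℚ)).symm ⟨p, Fact.out⟩).adicCompletion ℚ)
        (w.1.adicCompletion (CyclotomicField m ℚ)) (μ * ℓ))‖ ≤ 1) :
    ∃ (Λ₀ : Set (ℚ_[p] ⊗[ℚ] CyclotomicField m ℚ)) (M : Submodule ℤ_[p] (ℚ_[p] ⊗[ℚ] CyclotomicField m ℚ)),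
      Λ₀ ⊆ Submodule.span ℤ_[p]
        (Set.range fun b : 𝓞 (CyclotomicField m ℚ) ↦ (1 : ℚ_[p]) ⊗ₜ[ℚ] (b : CyclotomicField m ℚ)) ∧
      (∃ ℓ ∈ Λ₀, ‖Algebra.trace ℚ_[p] (ℚ_[p] ⊗[ℚ] CyclotomicField m ℚ) ℓ‖ = 1) ∧
      (∀ μ ∈ M, ∀ ℓ ∈ Λ₀, ‖Algebra.trace ℚ_[p] (ℚ_[p] ⊗[ℚ] CyclotomicField m ℚ) (μ * ℓ)‖ ≤ 1) ∧
      (∀ (k : ℕ) (D : ℚ_[p] ⊗[ℚ] CyclotomicField m ℚ),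
        (∀ w, ∃ μ ∈ M' w, Ψ D w = ((p : w.1.adicCompletion (CyclotomicField m ℚ)) ^ (k + 1)) * μ) →
        ∃ μ ∈ M, D = ((p : ℤ_[p]) ^ (k + 1)) • μ) := by
  classical
  letI : Fintype (((Rat.HeightOneSpectrum.primesEquiv (R := 𝓞 ℚ)).symm ⟨p, Fact.out⟩).Extension
      (𝓞 (CyclotomicField m ℚ))) :=
    HeightOneSpectrum.Extension.fintype (𝓞 ℚ) ℚ (CyclotomicField m ℚ) (𝓞 (CyclotomicField m ℚ)) _
  have hΨ' : ∀ (s : ℚ_[p]) (x : CyclotomicField m ℚ)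
      (w : ((Rat.HeightOneSpectrum.primesEquiv (R := 𝓞 ℚ)).symm ⟨p, Fact.out⟩).Extension
        (𝓞 (CyclotomicField m ℚ))),
      Ψ.toAlgHom (s ⊗ₜ[ℚ] x) w =
        algebraMap (CyclotomicField m ℚ) (w.1.adicCompletion (CyclotomicField m ℚ)) x *
        algebraMap (((Rat.HeightOneSpectrum.primesEquiv (R := 𝓞 ℚ)).symm ⟨p, Fact.out⟩).adicCompletion ℚ)
          (w.1.adicCompletion (CyclotomicField m ℚ)) (Padic.adicCompletionEquiv (𝓞 ℚ) ⟨p, Fact.out⟩ s) :=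
    fun s x w => hΨ s x w
  -- the trace formula `e (Tr t) = Σ_w Tr_w (Ψ t w)` (w2-acc4 `padicTensor_trace`)
  have htr : ∀ t : ℚ_[p] ⊗[ℚ] CyclotomicField m ℚ,
      Algebra.trace ℚ_[p] (ℚ_[p] ⊗[ℚ] CyclotomicField m ℚ) t =
        (Padic.adicCompletionEquiv (𝓞 ℚ) ⟨p, Fact.out⟩).symm
          (∑ w : ((Rat.HeightOneSpectrum.primesEquiv (R := 𝓞 ℚ)).symm ⟨p, Fact.out⟩).Extension
              (𝓞 (CyclotomicField m ℚ)),
            Algebra.trace (((Rat.HeightOneSpectrum.primesEquiv (R := 𝓞 ℚ)).symm ⟨p, Fact.out⟩).adicCompletion ℚ)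
              (w.1.adicCompletion (CyclotomicField m ℚ)) (Ψ t w)) := by
    intro t
    rw [← padicTensor_trace Ψ hΨ t, ContinuousAlgEquiv.symm_apply_apply]
  -- the lattice and the module
  refine ⟨{x | x ∈ Submodule.span ℤ_[p]
      (Set.range fun b : 𝓞 (CyclotomicField m ℚ) ↦ (1 : ℚ_[p]) ⊗ₜ[ℚ] (b : CyclotomicField m ℚ)) ∧
      ∀ w, Ψ x w ∈ Λ₀' w},
    Submodule.span ℤ_[p] {x | ∀ w, Ψ x w ∈ M' w}, fun x hx => hx.1, ?_, ?_, ?_⟩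
  · -- the unit-trace element: `Ψ⁻¹` of the family `(ℓ₀ at w₀, 0 elsewhere)`
    obtain ⟨w₀, ℓ₀, hℓ₀, hunit⟩ := hu'
    obtain ⟨t, ht, hΨt⟩ := exists_mem_span_padicTensor_eq Ψ.toAlgHom
      hΨ' (Pi.single w₀ ℓ₀) (fun w => by
        by_cases hw : w = w₀
        · subst hw; rw [Pi.single_eq_same]; exact hΛ₀' w hℓ₀
        · rw [Pi.single_eq_of_ne hw]; exact zero_mem _)
    have hΨt' : ∀ w, Ψ t w = Pi.single (M := fun w : ((Rat.HeightOneSpectrum.primesEquiv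
        (R := 𝓞 ℚ)).symm ⟨p, Fact.out⟩).Extension (𝓞 (CyclotomicField m ℚ)) =>
        w.1.adicCompletion (CyclotomicField m ℚ)) w₀ ℓ₀ w := fun w => by
      rw [← hΨt]; rfl
    refine ⟨t, ⟨ht, fun w => ?_⟩, ?_⟩
    · rw [hΨt']
      by_cases hw : w = w₀
      · subst hw; rw [Pi.single_eq_same]; exact hℓ₀
      · rw [Pi.single_eq_of_ne hw]; exact h0 w
    · rw [htr t, Finset.sum_eq_single w₀ (fun w _ hw => by rw [hΨt', Pi.single_eq_of_ne hw, map_zero])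
        (fun h => (h (Finset.mem_univ _)).elim), hΨt', Pi.single_eq_same]
      exact hunit
  · -- (hM) for the `ℤ_p`-span, by span induction from the per-factor (hM')
    intro μ hμ ℓ hℓ
    induction hμ using Submodule.span_induction with
    | mem x hx =>
      rw [htr, map_sum]
      refine norm_sum_le_one p _ _ fun w _ => ?_
      rw [map_mul, Pi.mul_apply]
      exact hM' w _ (hx w) _ (hℓ.2 w)
    | zero => rw [zero_mul, map_zero, norm_zero]; exact zero_le_one
    | add a c _ _ ha hc =>
      rw [add_mul, map_add]
      exact (Padic.nonarchimedean _ _).trans (max_le ha hc)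
    | smul r a _ ha =>
      rw [smul_mul_assoc, padicInt_smul_eq_coe_smul, map_smul, smul_eq_mul, norm_mul]
      exact mul_le_one₀ (PadicInt.norm_le_one r) (norm_nonneg _) ha
  · -- COMPAT transport: `Ψ D = p^{k+1} · (μ_w)_w` factor by factor ⟹ `D = p^{k+1} • Ψ⁻¹ (μ_w)_w`
    intro k D hD
    choose μ hμM hμ using hD
    refine ⟨Ψ.symm μ, Submodule.subset_span (fun w => by
      rw [AlgEquiv.apply_symm_apply]; exact hμM w), Ψ.injective ?_⟩
    funext w
    rw [hμ w, padicInt_smul_eq_coe_smul]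
    change _ = Ψ.toAlgHom (((((p : ℤ_[p]) ^ (k + 1) : ℤ_[p]) : ℚ_[p])) • Ψ.symm μ) w
    rw [padicTensor_map_smul Ψ.toAlgHom hΨ']
    change _ = _ * Ψ (Ψ.symm μ) w
    rw [AlgEquiv.apply_symm_apply, PadicInt.coe_pow, PadicInt.coe_natCast, map_pow, map_natCast, map_pow,
      map_natCast]

end PerFactor


end Summit.BirchSwinnertonDyer.BirchSwinnertonDyer.Theorems.KimAtThreeFineKatoSemiLocalTransport

end
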